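import Summits.CriticalPhenomena.PercolationContinuityZ3.Theses.PercNearOneGluing
import Literature.Probability.Percolation.PercolationProofs
import Literature.Probability.Percolation.ConditionalPositiveAssociationProofs
import Literature.Probability.Percolation.TwoClusterConditionalAssociationProofs

/-! TTRL-lite variant V120 of stmt-CriticalPhenomena-4576 -/

namespace Summit.CriticalPhenomena.PercolationContinuityZ3.Theorems

open MeasureTheory Literature.Probability.LatticeModels Literature.Probability.Percolation
open scoped Classical BigOperators

/-- TTRL-lite variant V120 (`n := 2`) of the good-step inequality behind
`stmt-CriticalPhenomena-4576` (AdditiveGluing).  On `Fin 2` the statement is vacuous: with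
`o ∉ A` and `b ∈ A` we have `{o, b} = Fin 2`, so there is no third vertex `y ∉ A` with `y ≠ o`,
and the hypothesis `∃ y, y ∉ A ∧ y ≠ o ∧ w s(o, y) ≠ 0` is contradictory. -/
theorem cp4576_goodstep_var120 :
    ∀ (w : Sym2 (Fin 2) → unitInterval) (A : Finset (Fin 2)) (o b : Fin 2), b ∈ A → o ∉ A →
    (∃ y : Fin 2, y ∉ A ∧ y ≠ o ∧ (w s(o, y) : ℝ) ≠ 0) →
    (∀ w' : Sym2 (Fin 2) → unitInterval,
      (Finset.univ.filter (fun v : Fin 2 => ∃ u : Fin 2, 0 < (w' s(u, v) : ℝ))).card <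
        (Finset.univ.filter (fun v : Fin 2 => ∃ u : Fin 2, 0 < (w s(u, v) : ℝ))).card →
      ∀ (A' : Finset (Fin 2)) (o' b' : Fin 2), b' ∈ A' → o' ∉ A' →
      ∀ (t : ℝ) (sel : Finset (Fin 2) → Fin 2), (∀ W, sel W ∈ A') →
      (∀ a ∈ A', 1 - t ≤ (prodBernoulli w').real (openConn a b')) →
      (prodBernoulli w').real ((⋃ a ∈ A', openConn o' a) ∩ (openConn o' b')ᶜ) +
        ∑ W ∈ (Finset.univ : Finset (Finset (Fin 2))).filter (fun W => o' ∈ W ∧ Disjoint W A'),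
          (prodBernoulli w').real {ω : BondConfig (Fin 2) | openCluster ω o' = (W : Set (Fin 2))} *
            (prodBernoulli w').real (openConnIn ((W : Set (Fin 2))ᶜ) (sel W) b')ᶜ ≤ t) →
    ∀ (t : ℝ) (sel : Finset (Fin 2) → Fin 2), (∀ W, sel W ∈ A) →
    (∀ a ∈ A, 1 - t ≤ (prodBernoulli w).real (openConn a b)) →
    (prodBernoulli w).real ((⋃ a ∈ A, openConn o a) ∩ (openConn o b)ᶜ) +
      ∑ W ∈ (Finset.univ : Finset (Finset (Fin 2))).filter (fun W => o ∈ W ∧ Disjoint W A),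
        (prodBernoulli w).real {ω : BondConfig (Fin 2) | openCluster ω o = (W : Set (Fin 2))} *
          (prodBernoulli w).real (openConnIn ((W : Set (Fin 2))ᶜ) (sel W) b)ᶜ ≤ t := by
  intro w A o b hb ho hy
  exfalso
  obtain ⟨y, hyA, hyo, -⟩ := hy
  have hob : o ≠ b := fun h => ho (h ▸ hb)
  have hyb : y ≠ b := fun h => hyA (h ▸ hb)
  have h1 := Fin.val_ne_of_ne hob
  have h2 := Fin.val_ne_of_ne hyb
  have h3 := Fin.val_ne_of_ne hyo
  have := y.isLt
  have := o.isLt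
  have := b.isLt
  omega

end Summit.CriticalPhenomena.PercolationContinuityZ3.Theorems
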